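import Summits.Ventures.DiscreteObjects.PP12.FlagTenConjunctC1
import Summits.Ventures.DiscreteObjects.PP12.FlagTenGammaSeparates

/-!
# The `f = 10` flag-cell orbit data: equation (R1) at subtype level (kernel; Step D, conjunct 5 of `IsFlagTenOrbitMatrix` before transport)
Framing: lottery ticket; floor = certified bounds/negative ranges.

Cell pub-namedobj (venture DiscreteObjects), target (M), designs gen 14 (HOME designs-g13 FAMILY-FLAG7X §7c). Setting as in
`FlagTenOrbitDataOfPlane` (`σ³ = 1`, flag type, `f = 10`, order 12, `u₀ ∋ c` a non-fixed line; vertices = points `≠ c` of `u₀`).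
For two vertices `x ≠ x'`:
`#{m fixed, m ≠ l : gammaOrb m x = gammaOrb m x'} = if phiVertex x = x' ∨ phiVertex x' = x then 0 else 2` (**`side_pair_count`**),
i.e. conjunct 5 `#{j : γ j i = γ j i'} = if (φ i = i' ∨ φ i' = i) then 0 else 2` before transport. It is the plane-level identity
`OrbitSideIdentities.side_side_identity` (λ = 1 for the two sides `x·σx`, `x'·σx'`), with the points of the side `x·σx` sorted into
its Z-point on `l` (always counted: the non-fixed points of `l` form one orbit, `lpoints_eq_orb3`), its T-points on the fixed lines
`m ≠ l` (counted iff the two `γ`-orbits on `m` agree), its own vertices (excluded) and its odd point (never counted: an exterior point of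
a side outside the side's triangle determines the vertex `v` with `phiVertex v =` the side's vertex, `phiVertex_of_odd`, so a common
orbit would force `x = x'`); the own-triangle terms are `[phiVertex x = x']`, `[phiVertex x' = x]` by `FlagTenPhiChar.card_sides_through`
and the incidence symmetry `OrbitCountOrderThree.orb3_incidence_symm`. No `sorry`, no new axioms.
-/

namespace Summit.Ventures.DiscreteObjects.PP12

open Configuration Finset
open scoped Classical

namespace Collineation

variable {P L : Type*} [Membership P L] [ProjectivePlane P L] [Fintype P] [Fintype L] (σ : Collineation P L)

omit [ProjectivePlane P L] [Fintype P] [Fintype L] in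
/-- A point of the orbit of `q ∈ a` lies on a line of the orbit of `a`. -/
theorem exists_orbLine_through {a : L} {q v : P} (hqa : q ∈ a) (hv : v ∈ orb3 σ.onPoints q) :
    ∃ g ∈ orb3 σ.onLines a, v ∈ g := by
  rw [mem_orb3] at hv
  rcases hv with rfl | rfl | rfl
  · exact ⟨a, self_mem_orb3 _ _, hqa⟩
  · exact ⟨σ.onLines a, (mem_orb3 _ _ _).2 (Or.inr (Or.inl rfl)), σ.mem_map hqa⟩
  · exact ⟨σ.onLines (σ.onLines a), (mem_orb3 _ _ _).2 (Or.inr (Or.inr rfl)), σ.mem_map (σ.mem_map hqa)⟩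

omit [ProjectivePlane P L] [Fintype P] [Fintype L] in
/-- The orbit of a point of a fixed line `k` stays on `k`. -/
theorem mem_fixedLine_of_mem_orb3 {k : L} (hk : σ.onLines k = k) {p q' : P} (hpk : p ∈ k) (hq' : q' ∈ orb3 σ.onPoints p) :
    q' ∈ k := by
  rw [mem_orb3] at hq'
  rcases hq' with rfl | rfl | rfl
  · exact hpk
  · exact (σ.mem_fixedLine_iff hk _).2 hpk
  · exact (σ.mem_fixedLine_iff hk _).2 ((σ.mem_fixedLine_iff hk _).2 hpk)

section Flag

variable {l : L} {c : P} (hl : σ.onLines l = l) (hc : σ.onPoints c = c) (hcl : c ∈ l)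
  (hP : ∀ p : P, σ.onPoints p = p → p ∈ l) (hL : ∀ m : L, σ.onLines m = m → c ∈ m)
  (h12 : ProjectivePlane.order P L = 12)

include hl hc hcl hP hL h12 in
/-- **The odd point determines `φ⁻¹`** (`f = 10`): if an exterior point `q` lies on the side `x·σx` of the vertex `x` but not in the
triangle of `x`, then the vertex `v` on `u₀` of the triangle of `q` satisfies `phiVertex v = x` (the triangle of `v` is inscribed in the
triangle of `x`). -/
theorem phiVertex_of_odd (hq : σ.onPoints ^ 3 = 1) (hf : fixedCard σ.onPoints = 10) {u₀ : L} (hcu₀ : c ∈ u₀) (hu₀ : σ.onLines u₀ ≠ u₀)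
    {x : P} (hxu : x ∈ u₀) (hxc : x ≠ c) {q : P} (hqa : q ∈ σ.sideOf l x) (hqX : ∀ m : L, σ.onLines m = m → q ∉ m)
    (hqx : q ∉ orb3 σ.onPoints x) {v : P} (hvu : v ∈ u₀) (hvq : v ∈ orb3 σ.onPoints q) :
    v ≠ c ∧ σ.phiVertex l c u₀ v = x := by
  have hvX := σ.exterior_of_mem_orb3 hqX hvq
  have hvc : v ≠ c := fun e => hvX l hl (e ▸ hcl)
  have hvx : v ≠ x := by
    intro e
    apply hqx
    rw [e] at hvq
    rw [orb3_eq_of_mem σ.onPoints hq hvq]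
    exact self_mem_orb3 _ _
  obtain ⟨g, hg, hvg⟩ := σ.exists_orbLine_through hqa hvq
  exact ⟨hvc, (σ.phiVertex_eq_iff hl hc hcl hP hL h12 hq hf hcu₀ hu₀ hvu hvc hxu hxc hvx).2 ⟨g, hg, hvg⟩⟩

include hl hc hcl hP hL h12 in
/-- **(R1) at subtype level** (`f = 10`): see the module docstring. -/
theorem side_pair_count (hq : σ.onPoints ^ 3 = 1) (hf : fixedCard σ.onPoints = 10) {u₀ : L} (hcu₀ : c ∈ u₀) (hu₀ : σ.onLines u₀ ≠ u₀)
    {x x' : P} (hxu : x ∈ u₀) (hxc : x ≠ c) (hx'u : x' ∈ u₀) (hx'c : x' ≠ c) (hxx' : x ≠ x') :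
    (univ.filter fun m : L => σ.onLines m = m ∧ m ≠ l ∧ σ.gammaOrb l c m x = σ.gammaOrb l c m x').card
      = if σ.phiVertex l c u₀ x = x' ∨ σ.phiVertex l c u₀ x' = x then 0 else 2 := by
  have hqL : σ.onLines ^ 3 = 1 := σ.onLines_pow_eq_one hq
  have hxX := σ.exterior_of_mem_cline hL hcu₀ hu₀ hxu hxc
  have hx'X := σ.exterior_of_mem_cline hL hcu₀ hu₀ hx'u hx'c
  have hxf : σ.onPoints x ≠ x := σ.not_fixed_of_exterior_flag hl hP hxX
  have hx'f : σ.onPoints x' ≠ x' := σ.not_fixed_of_exterior_flag hl hP hx'X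
  obtain ⟨hxa, hσxa⟩ := σ.sideOf_spec l hxf
  obtain ⟨hna, ha0⟩ := σ.side_no_fixed_point hxf hxX hxa hσxa
  obtain ⟨hx'a', hσx'a'⟩ := σ.sideOf_spec l hx'f
  obtain ⟨hna', ha0'⟩ := σ.side_no_fixed_point hx'f hx'X hx'a' hσx'a'
  -- the two triangles differ (`u₀` meets each orbit once)
  have hx'nx : x' ∉ orb3 σ.onPoints x := fun h' => hxx' (σ.vertex_eq_of_mem_orb3 hc hq hcu₀ hu₀ hx'u hxu h').symm
  have hoo : orb3 σ.onPoints x ≠ orb3 σ.onPoints x' := fun e => hx'nx (by rw [e]; exact self_mem_orb3 _ _)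
  -- (R1) at plane level for the two sides
  have hid := σ.side_side_identity hq hxf hx'f hoo hna hxa hσxa (fun q hqa hqf => ha0 q hqf hqa) hna' hx'a' hσx'a'
  -- the own-triangle terms
  have h3x : (orb3 σ.onPoints x).card = 3 := card_orb3_of_ne _ hq hxf
  have h3x' : (orb3 σ.onPoints x').card = 3 := card_orb3_of_ne _ hq hx'f
  have h3a : (orb3 σ.onLines (σ.sideOf l x)).card = 3 := card_orb3_of_ne _ hqL hna
  have h3a' : (orb3 σ.onLines (σ.sideOf l x')).card = 3 := card_orb3_of_ne _ hqL hna'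
  have hT1 : ((orb3 σ.onPoints x).filter fun q' => q' ∈ σ.sideOf l x').card = if σ.phiVertex l c u₀ x = x' then 1 else 0 := by
    have hs := σ.orb3_incidence_symm hq x (σ.sideOf l x')
    rw [h3x, h3a', σ.card_sides_through hl hc hcl hP hL h12 hq hf hcu₀ hu₀ hxu hxc hx'u hx'c hxx'] at hs
    exact (Nat.eq_of_mul_eq_mul_right (by norm_num) hs).symm
  have hT2 : ((orb3 σ.onPoints x').filter fun q' => q' ∈ σ.sideOf l x).card = if σ.phiVertex l c u₀ x' = x then 1 else 0 := by
    have hs := σ.orb3_incidence_symm hq x' (σ.sideOf l x)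
    rw [h3x', h3a, σ.card_sides_through hl hc hcl hP hL h12 hq hf hcu₀ hu₀ hx'u hx'c hxu hxc hxx'.symm] at hs
    exact (Nat.eq_of_mul_eq_mul_right (by norm_num) hs).symm
  rw [hT1, hT2] at hid
  -- the third term: the Z-point of the side, and its T-points on the fixed lines with agreeing γ
  set N : Finset L := univ.filter fun m : L => σ.onLines m = m ∧ m ≠ l ∧ σ.gammaOrb l c m x = σ.gammaOrb l c m x' with hN
  set R : Finset P := univ.filter fun q : P => q ∈ σ.sideOf l x ∧ q ∉ orb3 σ.onPoints x ∧ q ∉ orb3 σ.onPoints x' ∧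
      ∃ q' ∈ orb3 σ.onPoints q, q' ∈ σ.sideOf l x' with hR_def
  have hal : σ.sideOf l x ≠ l := fun e => ha0 c hc (by rw [e]; exact hcl)
  have ha'l : σ.sideOf l x' ≠ l := fun e => ha0' c hc (by rw [e]; exact hcl)
  obtain ⟨hza, hzl⟩ := meetPt_spec c hal
  obtain ⟨hz'a', hz'l⟩ := meetPt_spec c ha'l
  have hzf : σ.onPoints (meetPt c (σ.sideOf l x) l) ≠ meetPt c (σ.sideOf l x) l := fun e => ha0 _ e hza
  have hz'f : σ.onPoints (meetPt c (σ.sideOf l x') l) ≠ meetPt c (σ.sideOf l x') l := fun e => ha0' _ e hz'a'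
  -- exterior orbits avoid the fixed lines
  have notin_ext : ∀ {p : P} {k : L}, σ.onLines k = k → p ∈ k → ∀ {E : P}, (∀ m' : L, σ.onLines m' = m' → E ∉ m') →
      p ∉ orb3 σ.onPoints E := by
    intro p k hk hpk E hEX hp
    exact (σ.exterior_of_mem_orb3 hEX hp) k hk hpk
  have hRdesc : R = insert (meetPt c (σ.sideOf l x) l) (N.image fun m => meetPt c (σ.sideOf l x) m) := by
    ext q
    rw [hR_def, mem_filter, mem_insert, mem_image]
    constructor
    · rintro ⟨-, hqa, hq1, hq2, q', hq', hq'a'⟩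
      by_cases hfix : ∃ m : L, σ.onLines m = m ∧ q ∈ m
      · obtain ⟨m, hm, hqm⟩ := hfix
        by_cases hml : m = l
        · left
          rw [hml] at hqm
          exact meetPt_eq c hal hqa hqm
        · right
          have ham : σ.sideOf l x ≠ m := fun e => ha0 c hc (e ▸ hL m hm)
          have ha'm : σ.sideOf l x' ≠ m := fun e => ha0' c hc (e ▸ hL m hm)
          have hq'm : q' ∈ m := σ.mem_fixedLine_of_mem_orb3 hm hqm hq'
          refine ⟨m, ?_, (meetPt_eq c ham hqa hqm).symm⟩
          rw [hN, mem_filter]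
          refine ⟨mem_univ _, hm, hml, ?_⟩
          change orb3 σ.onPoints (meetPt c (σ.sideOf l x) m) = orb3 σ.onPoints (meetPt c (σ.sideOf l x') m)
          rw [← meetPt_eq c ham hqa hqm, ← meetPt_eq c ha'm hq'a' hq'm]
          exact (orb3_eq_of_mem σ.onPoints hq hq').symm
      · -- q is an exterior point of the side outside the triangle of x: its orbit cannot reach the other side
        exfalso
        push Not at hfix
        have hqX : ∀ m : L, σ.onLines m = m → q ∉ m := fun m hm hqm => hfix m hm hqm
        obtain ⟨v, hvq, hvu⟩ := σ.exterior_orbit_meets_cline hl hc hcl hL h12 hq hf hcu₀ hu₀ hqX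
        obtain ⟨hvc, hφ1⟩ := σ.phiVertex_of_odd hl hc hcl hP hL h12 hq hf hcu₀ hu₀ hxu hxc hqa hqX hq1 hvu hvq
        have hq'X := σ.exterior_of_mem_orb3 hqX hq'
        have hoq' : orb3 σ.onPoints q' = orb3 σ.onPoints q := orb3_eq_of_mem σ.onPoints hq hq'
        have hq'x' : q' ∉ orb3 σ.onPoints x' := by
          intro h'
          apply hq2
          rw [← orb3_eq_of_mem σ.onPoints hq h', hoq']
          exact self_mem_orb3 _ _
        have hvq' : v ∈ orb3 σ.onPoints q' := by rw [hoq']; exact hvq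
        obtain ⟨-, hφ2⟩ := σ.phiVertex_of_odd hl hc hcl hP hL h12 hq hf hcu₀ hu₀ hx'u hx'c hq'a' hq'X hq'x' hvu hvq'
        exact hxx' (hφ1.symm.trans hφ2)
    · rintro (hq0 | ⟨m, hmN, hq0⟩)
      · rw [hq0]
        refine ⟨mem_univ _, hza, notin_ext hl hzl hxX, notin_ext hl hzl hx'X, meetPt c (σ.sideOf l x') l, ?_, hz'a'⟩
        exact σ.lpoints_eq_orb3 hl hP h12 hq hf hzl hzf hz'l hz'f
      · rw [hN, mem_filter] at hmN
        obtain ⟨-, hm, -, hγ⟩ := hmN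
        have ham : σ.sideOf l x ≠ m := fun e => ha0 c hc (e ▸ hL m hm)
        have ha'm : σ.sideOf l x' ≠ m := fun e => ha0' c hc (e ▸ hL m hm)
        obtain ⟨hwa, hwm⟩ := meetPt_spec c ham
        obtain ⟨hw'a', -⟩ := meetPt_spec c ha'm
        rw [← hq0]
        refine ⟨mem_univ _, hwa, notin_ext hm hwm hxX, notin_ext hm hwm hx'X, meetPt c (σ.sideOf l x') m, ?_, hw'a'⟩
        change orb3 σ.onPoints (meetPt c (σ.sideOf l x) m) = orb3 σ.onPoints (meetPt c (σ.sideOf l x') m) at hγ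
        rw [hγ]; exact self_mem_orb3 _ _
  -- counting: the Z-point is not a T-point, and `m ↦ side ∩ m` is injective on the fixed lines
  have hz_nim : meetPt c (σ.sideOf l x) l ∉ N.image (fun m => meetPt c (σ.sideOf l x) m) := by
    rw [mem_image]
    rintro ⟨m, hmN, hk⟩
    rw [hN, mem_filter] at hmN
    obtain ⟨-, hm, hml, -⟩ := hmN
    have ham : σ.sideOf l x ≠ m := fun e => ha0 c hc (e ▸ hL m hm)
    obtain ⟨-, hwm⟩ := meetPt_spec c ham
    rw [hk] at hwm
    have hwc : meetPt c (σ.sideOf l x) l ≠ c := fun e => ha0 c hc (e ▸ hza)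
    exact hml ((Nondegenerate.eq_or_eq hwm (hL m hm) hzl hcl).resolve_left hwc)
  have hinj : Set.InjOn (fun m => meetPt c (σ.sideOf l x) m) ↑N := by
    intro m₁ hm₁ m₂ hm₂ hk
    rw [mem_coe, hN, mem_filter] at hm₁ hm₂
    obtain ⟨-, hm₁f, -, -⟩ := hm₁
    obtain ⟨-, hm₂f, -, -⟩ := hm₂
    have ham₁ : σ.sideOf l x ≠ m₁ := fun e => ha0 c hc (e ▸ hL m₁ hm₁f)
    have ham₂ : σ.sideOf l x ≠ m₂ := fun e => ha0 c hc (e ▸ hL m₂ hm₂f)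
    obtain ⟨hw₁a, hw₁m⟩ := meetPt_spec c ham₁
    obtain ⟨-, hw₂m⟩ := meetPt_spec c ham₂
    have hk' : meetPt c (σ.sideOf l x) m₁ = meetPt c (σ.sideOf l x) m₂ := hk
    rw [← hk'] at hw₂m
    have hwc : meetPt c (σ.sideOf l x) m₁ ≠ c := fun e => ha0 c hc (e ▸ hw₁a)
    by_contra hne
    exact hwc ((Nondegenerate.eq_or_eq hw₁m (hL m₁ hm₁f) hw₂m (hL m₂ hm₂f)).resolve_right hne)
  have hRcard : R.card = N.card + 1 := by
    rw [hRdesc, card_insert_of_notMem hz_nim, card_image_of_injOn hinj]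
  rw [hRcard] at hid
  by_cases hB : σ.phiVertex l c u₀ x = x'
  · rw [if_pos hB] at hid
    rw [if_pos (Or.inl hB)]
    by_cases hA : σ.phiVertex l c u₀ x' = x
    · rw [if_pos hA] at hid; omega
    · rw [if_neg hA] at hid; omega
  · rw [if_neg hB] at hid
    by_cases hA : σ.phiVertex l c u₀ x' = x
    · rw [if_pos hA] at hid
      rw [if_pos (Or.inr hA)]
      omega
    · rw [if_neg hA] at hid
      rw [if_neg (not_or.2 ⟨hB, hA⟩)]
      omega

end Flag

end Collineation

end Summit.Ventures.DiscreteObjects.PP12
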